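import Mathlib
import Summits.MatrixMultiplication.MatrixMultiplication.Theses.AbelianSTPPCensusVP

/-!
# Kernel sanity check of the TYPED crux `GrynkiewiczWeak` on the abelian groups of order ≤ 5

`decide` evaluates the crux body verbatim (the tree's `Nt`, `repCount`) for `G = ZMod n` (n ≤ 5) and `ZMod 2 × ZMod 2` over all `(X, Y, t)` — one type per isomorphism class of abelian groups of order ≤ 5 (orders 6, 7 exceed a 10-minute elaboration budget and are left to the Python check):
a check that the Lean typing of the constants (`2t²`, `+1`, `+4`, `ℓ + 1 ≤ t`) means what the exhaustive Python check (kit j248928 /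
j248960, all abelian groups of order ≤ 17, 0 violations) reads it to mean.  Cell mm-stpp, planner gen 7.
-/

set_option linter.dupNamespace false

namespace Summit.MatrixMultiplication.MatrixMultiplication.Theorems

namespace AbelianSTPPCensusVP

open Finset

/-- the crux body at a fixed group -/
def GWBody (G : Type) [AddCommGroup G] [Fintype G] [DecidableEq G] : Prop :=
  ∀ (X Y : Finset G) (t : ℕ), 2 ≤ t → t ≤ X.card → t ≤ Y.card →
    (((3 ≤ t → t * (X.card + Y.card) + 1 ≤ Nt X Y t + 2 * t ^ 2) ∧ (t = 2 → 2 * (X.card + Y.card) ≤ Nt X Y 2 + 4)) ∨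
      ∃ X' ⊆ X, ∃ Y' ⊆ Y, (X \ X').card + (Y \ Y').card + 1 ≤ t ∧ ∀ x ∈ X', ∀ y ∈ Y', t ≤ repCount X Y (x + y))

/-- the typed crux `GrynkiewiczWeak` is, by `Iff.rfl`, the statement that `GWBody G` holds for every finite abelian group `G` -/
theorem gw_iff : Summit.MatrixMultiplication.MatrixMultiplication.Theses.AbelianSTPPCensusVP.GrynkiewiczWeak ↔
    ∀ (G : Type) [AddCommGroup G] [Fintype G] [DecidableEq G], GWBody G := Iff.rfl

set_option maxRecDepth 20000 in
/-- the crux body holds at `ZMod 2` (kernel evaluation by `decide`) -/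
theorem gw_zmod2 : GWBody (ZMod 2) := by
  unfold GWBody; decide

set_option maxRecDepth 20000 in
/-- the crux body holds at `ZMod 3` (kernel evaluation by `decide`) -/
theorem gw_zmod3 : GWBody (ZMod 3) := by
  unfold GWBody; decide

set_option maxRecDepth 20000 in
set_option maxHeartbeats 4000000 in
/-- the crux body holds at `ZMod 4` (kernel evaluation by `decide`) -/
theorem gw_zmod4 : GWBody (ZMod 4) := by
  unfold GWBody; decide

set_option maxRecDepth 20000 in
set_option maxHeartbeats 4000000 in
/-- the crux body holds at the Klein four-group `ZMod 2 × ZMod 2` (kernel evaluation by `decide`) -/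
theorem gw_klein : GWBody (ZMod 2 × ZMod 2) := by
  unfold GWBody; decide

set_option maxRecDepth 20000 in
set_option maxHeartbeats 40000000 in
/-- the crux body holds at `ZMod 5` (kernel evaluation by `decide`) -/
theorem gw_zmod5 : GWBody (ZMod 5) := by
  unfold GWBody; decide

end AbelianSTPPCensusVP

end Summit.MatrixMultiplication.MatrixMultiplication.Theorems
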